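import Mathlib
import Summits.ValiantsHypothesis.ValiantsHypothesis.Theorems.BarrierLeverPartitionMinorsHitByVPHiddenStatesMoebiusInversion
import Summits.ValiantsHypothesis.ValiantsHypothesis.Theorems.BarrierLeverPartitionMinorsHitByVPHiddenStatesFreeCompletion
import Summits.ValiantsHypothesis.ValiantsHypothesis.Theorems.BarrierLeverPartitionMinorsHitByVPHiddenStatesTiltTable

/-!
# Route BarrierLever — item `PartitionMinorsHitByVP` (stmt-ValiantsHypothesis-19717), line `hidden-states`:
# THE DIAGONAL, CORE ONE — the big ball `B_{h−2}(h states)` serves the core-one down-set of co-size `h + 1`, every `h ≥ 3`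

Helper file (`--supports stmt-ValiantsHypothesis-19717`; cell valiant-natproofs, rung V4, 𝒟-side door (c), registered line
`Cruxes/PartitionMinorsHitByVP/Lines/hidden_states.lean` v7; prover seat val-np-p6 gen 12). Definition-free; closes NO item.

CONTEXT (memo val-np-p6 g12 §2, §4). By the core lift (p625816) the whole top window of the lower node is governed by the DIAGONAL cells
`D_{h+1}` = one design at level `h` serving every down-set of co-size `h + 1`; no design containing an affine `(h−1)`-cube can do it, and
the candidate is the single piece `B_{h−2}` on `h` states — in the language of the co-star program (p620405 ff.) the SATURATED co-star,
which the recursion there reaches only through its stuck shapes. Here is its first class for EVERY `h = n + 1 ≥ 3`, with an explicit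
table and no recursion: `coStarSaturated_coreOne` — rows = all subsets of `Fin (n+1)` except `univ`, the co-singletons `univ ∖ {i}`
(`i < n`) and the co-doubleton `univ ∖ {0, 1}` (missing up-set with core exactly `{last}`); columns = one piece, state sets `J` with
`|J| ≤ n − 1`; conclusion `symDet ≠ 0`. TABLE: `t_q = e_q` for `q < n`, `t_last = e_last − 1_{<n}` (ONE tilt). The columns `J ∌ last` are 0/1
points `1_J`; the columns `J = last ⊔ I` are `e_last − 1_{Iᶜ}` with entries `(−1)^{|T|}[T ∩ I = ∅]`. Independence: the `last`-rows make the
superset sums of `A ↦ f_B(Aᶜ)` vanish off `{univ ∖ z} ∪ {univ ∖ {0,1}}`; Möbius inversion (`Tilt.moebius_inversion`) at `∅` and at the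
singletons (where `f_B` vanishes for cardinality reasons) gives `n + 1` linear equations killing those `n + 1` values (the count `|{0,1}| = 2 ≠ 1`
is the whole point); then the `1_J`-coefficients die by Möbius inversion.

WHAT THIS IS NOT: one class of the diagonal cell (core one); the core-`s` classes (`s ≥ 2`, memo §2: an `s × s` determinant) are open;
nothing on crux 14610 or VP ≠ VNP.
-/

set_option linter.dupNamespace false

namespace Summit.ValiantsHypothesis.ValiantsHypothesis.Theorems.BarrierLever.HiddenStates

open Finset

noncomputable section

namespace Tilt

/-- **THE CORE-ONE CLASS OF THE DIAGONAL CELL.** See the module docstring. -/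
theorem coStarSaturated_coreOne (n r m : ℕ) (hn : 2 ≤ n) (p₀ : Fin m)
    (cols : Fin r → Finset (Fin (n + 1))) (hcols : Function.Injective cols) (hcolJ : ∀ k, (cols k).card + 2 ≤ n + 1)
    (u : Fin r → Finset (Fin (n + 1))) (hu : Function.Injective u)
    (hrowN : ∀ T : Finset (Fin n), T.map Fin.castSuccEmb ∈ Set.range u)
    (hrowX : ∀ T : Finset (Fin n), T ≠ Finset.univ → (∀ i, T ≠ Finset.univ.erase i) →
      T ≠ Finset.univ \ {⟨0, by omega⟩, ⟨1, by omega⟩} → insert (Fin.last n) (T.map Fin.castSuccEmb) ∈ Set.range u) :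
    SymbJoin.symDet u (fun k => (p₀, cols k)) ≠ 0 := by
  classical
  set cs : Fin n ↪ Fin (n + 1) := Fin.castSuccEmb with hcs
  set xl : Fin (n + 1) := Fin.last n with hxl
  have hcs_ne : ∀ i : Fin n, cs i ≠ xl := fun i => by rw [hcs, hxl]; exact (Fin.castSucc_lt_last i).ne
  let P : Finset (Fin n) := {⟨0, by omega⟩, ⟨1, by omega⟩}
  have hP01 : (⟨0, by omega⟩ : Fin n) ≠ ⟨1, by omega⟩ := fun h => by simp at h
  have hPc : P.card = 2 := Finset.card_pair hP01
  set Q : Finset (Fin n) := Finset.univ \ P with hQ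
  have hQc : Q.card = n - 2 := by
    rw [hQ, Finset.card_sdiff_of_subset (Finset.subset_univ _), Finset.card_univ, Fintype.card_fin, hPc]
  have hmemQ : ∀ i, i ∈ Q ↔ i ∉ P := fun i => by simp [hQ]
  -- the table: one tilt on the state `last`
  let tx : Fin m → Option (Fin (n + 1)) → Fin (n + 1) → ℂ := fun _ o a =>
    match o with
    | none => 0
    | some q => if q = xl then (if a = xl then 1 else -1) else (if a = q then 1 else 0)
  have he : Function.Injective (fun k => (p₀, cols k)) := fun k k' hkk => hcols (Prod.ext_iff.mp hkk).2
  refine SymbJoin.symGood_of_indepCore u hu (fun k => (p₀, cols k)) he {p₀}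
    (fun k hk => absurd (Finset.mem_singleton_self p₀) hk) tx ?_
  intro α _ hsum
  -- hidden points
  let pt : Fin r → Fin (n + 1) → ℂ := fun k a => tx p₀ none a + ∑ q ∈ cols k, tx p₀ (some q) a
  let low : Fin r → Finset (Fin n) := fun k => Finset.univ.filter fun i => cs i ∈ cols k
  have htxn : ∀ a, tx p₀ none a = 0 := fun a => rfl
  have hptc : ∀ k (i : Fin n), pt k (cs i) = (if i ∈ low k then 1 else 0) - (if xl ∈ cols k then 1 else 0) := by
    intro k i
    have h1 : ∀ q ∈ cols k, tx p₀ (some q) (cs i) = (if q = cs i then (1 : ℂ) else 0) - (if q = xl then 1 else 0) := by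
      intro q _
      by_cases hq : q = xl
      · have h2 : ¬ (xl = cs i) := fun h => hcs_ne i h.symm
        simp only [tx, hq, if_true, if_neg (hcs_ne i), h2, if_false]; norm_num
      · simp only [tx, if_neg hq, @eq_comm _ (cs i) q]; norm_num
    simp only [pt]
    rw [htxn (cs i), zero_add, Finset.sum_congr rfl h1, Finset.sum_sub_distrib, Finset.sum_ite_eq' (cols k) (cs i) (fun _ => (1 : ℂ)),
      Finset.sum_ite_eq' (cols k) xl (fun _ => (1 : ℂ))]
    simp only [low, Finset.mem_filter, Finset.mem_univ, true_and]
  have hptl : ∀ k, pt k xl = if xl ∈ cols k then 1 else 0 := by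
    intro k
    have h1 : ∀ q ∈ cols k, tx p₀ (some q) xl = if q = xl then (1 : ℂ) else 0 := by
      intro q _
      by_cases hq : q = xl
      · simp only [tx, hq, if_true]
      · simp only [tx, if_neg hq]
        rw [if_neg (fun h => hq h.symm)]
    simp only [pt]
    rw [htxn xl, zero_add, Finset.sum_congr rfl h1, Finset.sum_ite_eq' (cols k) xl (fun _ => (1 : ℂ))]
  -- products over a row
  have hprodA : ∀ k, xl ∉ cols k → ∀ T : Finset (Fin n), ∏ a ∈ T.map cs, pt k a = if T ⊆ low k then 1 else 0 := by
    intro k hk T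
    rw [Finset.prod_map]
    have : ∀ i ∈ T, pt k (cs i) = if i ∈ low k then 1 else 0 := fun i _ => by rw [hptc, if_neg hk, sub_zero]
    rw [Finset.prod_congr rfl this, Finset.prod_boole]
    by_cases h : T ⊆ low k
    · rw [if_pos h, if_pos (fun i hi => h hi)]
    · rw [if_neg h, if_neg (fun h' => h (fun i hi => h' i hi))]
  have hprodB : ∀ k, xl ∈ cols k → ∀ T : Finset (Fin n),
      ∏ a ∈ T.map cs, pt k a = (-1 : ℂ) ^ T.card * (if Disjoint T (low k) then 1 else 0) := by
    intro k hk T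
    rw [Finset.prod_map]
    have : ∀ i ∈ T, pt k (cs i) = if i ∈ low k then 0 else -1 := fun i _ => by
      rw [hptc, if_pos hk]; by_cases hi : i ∈ low k <;> simp [hi]
    rw [Finset.prod_congr rfl this]
    by_cases hdis : Disjoint T (low k)
    · rw [if_pos hdis, mul_one]
      have : ∀ i ∈ T, (if i ∈ low k then (0 : ℂ) else -1) = -1 := fun i hi =>
        if_neg (Finset.disjoint_left.mp hdis hi)
      rw [Finset.prod_congr rfl this, Finset.prod_const]
    · rw [if_neg hdis, mul_zero]
      obtain ⟨i, hiT, hiL⟩ : ∃ i ∈ T, i ∈ low k := by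
        by_contra hno; push Not at hno; exact hdis (Finset.disjoint_left.mpr hno)
      exact Finset.prod_eq_zero hiT (by rw [if_pos hiL])
  have hxl_notmem : ∀ T : Finset (Fin n), xl ∉ T.map cs := by
    intro T h'
    obtain ⟨i, -, hi⟩ := Finset.mem_map.mp h'
    exact hcs_ne i hi
  -- row equations
  set CA : Finset (Fin r) := Finset.univ.filter fun k => xl ∉ cols k with hCA
  set CB : Finset (Fin r) := Finset.univ.filter fun k => xl ∈ cols k with hCB
  let ΨA : Finset (Fin n) → ℂ := fun T => ∑ k ∈ CA, α k * (if T ⊆ low k then 1 else 0)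
  let ΨB : Finset (Fin n) → ℂ := fun T => ∑ k ∈ CB, α k * (if Disjoint T (low k) then 1 else 0)
  have hroweq : ∀ S, S ∈ Set.range u →
      ∑ k ∈ CA, α k * ∏ a ∈ S, pt k a + ∑ k ∈ CB, α k * ∏ a ∈ S, pt k a = 0 := by
    rintro S ⟨i₀, hi₀⟩
    have h1 := congrFun hsum i₀
    rw [Finset.sum_apply, Pi.zero_apply] at h1
    simp only [Pi.smul_apply, smul_eq_mul, hi₀] at h1
    rw [hCA, hCB, Finset.sum_filter_not_add_sum_filter]
    exact h1
  have hEN : ∀ T : Finset (Fin n), ΨA T + (-1 : ℂ) ^ T.card * ΨB T = 0 := by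
    intro T
    have := hroweq _ (hrowN T)
    have hA : ∀ k ∈ CA, α k * ∏ a ∈ T.map cs, pt k a = α k * (if T ⊆ low k then 1 else 0) := fun k hk => by
      rw [hprodA k (Finset.mem_filter.mp hk).2 T]
    have hB : ∀ k ∈ CB, α k * ∏ a ∈ T.map cs, pt k a
        = (-1 : ℂ) ^ T.card * (α k * (if Disjoint T (low k) then 1 else 0)) := fun k hk => by
      rw [hprodB k (Finset.mem_filter.mp hk).2 T]; ring
    rw [Finset.sum_congr rfl hA, Finset.sum_congr rfl hB, ← Finset.mul_sum] at this
    exact this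
  have hEX : ∀ T : Finset (Fin n), T ≠ Finset.univ → (∀ i, T ≠ Finset.univ.erase i) → T ≠ Q → ΨB T = 0 := by
    intro T h1 h2 h3
    have := hroweq _ (hrowX T h1 h2 (by rw [hQ] at h3; exact h3))
    have hA : ∀ k ∈ CA, α k * ∏ a ∈ insert xl (T.map cs), pt k a = 0 := fun k hk => by
      rw [Finset.prod_insert (hxl_notmem T), hptl, if_neg (Finset.mem_filter.mp hk).2]; ring
    have hB : ∀ k ∈ CB, α k * ∏ a ∈ insert xl (T.map cs), pt k a
        = (-1 : ℂ) ^ T.card * (α k * (if Disjoint T (low k) then 1 else 0)) := fun k hk => by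
      rw [Finset.prod_insert (hxl_notmem T), hptl, if_pos (Finset.mem_filter.mp hk).2, hprodB k (Finset.mem_filter.mp hk).2 T]
      ring
    rw [Finset.sum_congr rfl hA, Finset.sum_congr rfl hB, Finset.sum_const_zero, zero_add, ← Finset.mul_sum] at this
    rcases mul_eq_zero.mp this with h0 | h0
    · exact absurd h0 (pow_ne_zero _ (by norm_num))
    · exact h0
  -- fibres
  let fA : Finset (Fin n) → ℂ := fun J => ∑ k ∈ CA.filter (fun k => low k = J), α k
  let fB : Finset (Fin n) → ℂ := fun A => ∑ k ∈ CB.filter (fun k => Finset.univ \ low k = A), α k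
  have hΨAfib : ∀ T, ΨA T = ∑ J ∈ Finset.univ.filter (fun J => T ⊆ J), fA J := by
    intro T
    simp only [ΨA]
    rw [sum_mul_apply_eq_sum_fiber CA low α (fun J => if T ⊆ J then 1 else 0), Finset.sum_filter]
    refine Finset.sum_congr rfl fun J _ => ?_
    by_cases h : T ⊆ J <;> simp [h, fA]
  have hΨBfib : ∀ T, ΨB T = ∑ A ∈ Finset.univ.filter (fun A => T ⊆ A), fB A := by
    intro T
    simp only [ΨB]
    have h1 : ∀ k ∈ CB, α k * (if Disjoint T (low k) then (1 : ℂ) else 0)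
        = α k * (if T ⊆ Finset.univ \ low k then 1 else 0) := fun k _ => by
      have : Disjoint T (low k) ↔ T ⊆ Finset.univ \ low k := by
        rw [Finset.subset_sdiff]; exact ⟨fun h => ⟨Finset.subset_univ _, h⟩, fun h => h.2⟩
      simp only [this]
    rw [Finset.sum_congr rfl h1, sum_mul_apply_eq_sum_fiber CB (fun k => Finset.univ \ low k) α (fun A => if T ⊆ A then 1 else 0),
      Finset.sum_filter]
    refine Finset.sum_congr rfl fun A _ => ?_
    by_cases h : T ⊆ A <;> simp [h, fB]
  -- the columns are determined by `low` and the `last`-bit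
  have hmem_cs : ∀ k (i : Fin n), cs i ∈ cols k ↔ i ∈ low k := fun k i => by simp [low]
  have hcolsA : ∀ k, xl ∉ cols k → cols k = (low k).map cs := by
    intro k hk; ext q
    rcases Fin.eq_castSucc_or_eq_last q with ⟨i, rfl⟩ | rfl
    · rw [show Fin.castSucc i = cs i from rfl, Finset.mem_map' cs, hmem_cs]
    · constructor
      · intro h; exact absurd h hk
      · intro h; obtain ⟨i, -, hi⟩ := Finset.mem_map.mp h; exact absurd hi (hcs_ne i)
  have hcolsB : ∀ k, xl ∈ cols k → cols k = insert xl ((low k).map cs) := by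
    intro k hk; ext q
    rcases Fin.eq_castSucc_or_eq_last q with ⟨i, rfl⟩ | rfl
    · rw [Finset.mem_insert, show Fin.castSucc i = cs i from rfl, Finset.mem_map' cs, hmem_cs]
      constructor
      · intro h; exact Or.inr h
      · rintro (h | h)
        · exact absurd h (hcs_ne i)
        · exact h
    · constructor
      · intro _; exact Finset.mem_insert_self _ _
      · intro _; exact hk
  -- cardinalities: |low k| ≤ n − 1 on CA (so low k ≠ univ), |low k| ≤ n − 2 on CB
  have hlowA : ∀ k, xl ∉ cols k → low k ≠ Finset.univ := by
    intro k hk hlu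
    have h1 := hcolJ k
    rw [hcolsA k hk, Finset.card_map, hlu, Finset.card_univ, Fintype.card_fin] at h1
    omega
  have hlowB : ∀ k, xl ∈ cols k → (low k).card + 2 ≤ n := by
    intro k hk
    have h1 := hcolJ k
    rw [hcolsB k hk, Finset.card_insert_of_notMem (hxl_notmem _), Finset.card_map] at h1
    omega
  have hfA_univ : fA Finset.univ = 0 := by
    refine Finset.sum_eq_zero fun k hk => ?_
    obtain ⟨hkA, hlu⟩ := Finset.mem_filter.mp hk
    exact absurd hlu (hlowA k (Finset.mem_filter.mp hkA).2)
  have hfB_small : ∀ A : Finset (Fin n), A.card ≤ 1 → fB A = 0 := by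
    intro A hA
    refine Finset.sum_eq_zero fun k hk => ?_
    obtain ⟨hkB, hlu⟩ := Finset.mem_filter.mp hk
    have h1 := hlowB k (Finset.mem_filter.mp hkB).2
    have h2 : (Finset.univ \ low k).card = n - (low k).card := by
      rw [Finset.card_sdiff_of_subset (Finset.subset_univ _), Finset.card_univ, Fintype.card_fin]
    rw [hlu] at h2
    omega
  -- Ψ_B vanishes at univ (row `univ.map cs`), hence its superset sums are supported on the co-singletons and Q
  have hΨB_univ : ΨB Finset.univ = 0 := by
    have h1 := hEN Finset.univ
    rw [hΨAfib] at h1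
    have h2 : ∑ J ∈ Finset.univ.filter (fun J : Finset (Fin n) => Finset.univ ⊆ J), fA J = 0 := by
      refine Finset.sum_eq_zero fun J hJ => ?_
      have : J = Finset.univ := Finset.Subset.antisymm (Finset.subset_univ J) (Finset.mem_filter.mp hJ).2
      rw [this]; exact hfA_univ
    rw [h2, zero_add] at h1
    rcases mul_eq_zero.mp h1 with h0 | h0
    · exact absurd h0 (pow_ne_zero _ (by norm_num))
    · exact h0
  -- Möbius inversion of `fB` at `∅` and at the singletons
  let G : Finset (Fin n) → ℂ := fun X => (-1 : ℂ) ^ X.card * ΨB X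
  have hGzero : ∀ X, X ≠ Q → (∀ z, X ≠ Finset.univ.erase z) → G X = 0 := by
    intro X hXQ hXe
    by_cases hXu : X = Finset.univ
    · simp only [G, hXu, hΨB_univ, mul_zero]
    · simp only [G, hEX X hXu hXe hXQ, mul_zero]
  -- decomposition of a sum of a function vanishing off {Q} ∪ {univ.erase z}
  have hQnot : Q ∉ Finset.univ.image (fun z : Fin n => Finset.univ.erase z) := by
    intro h
    obtain ⟨z, -, hz⟩ := Finset.mem_image.mp h
    have := congrArg Finset.card hz
    rw [Finset.card_erase_of_mem (Finset.mem_univ z), Finset.card_univ, Fintype.card_fin, hQc] at this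
    omega
  have herase_inj : Function.Injective (fun z : Fin n => Finset.univ.erase z) :=
    fun z z' h => Finset.erase_injOn _ (Finset.mem_univ z) (Finset.mem_univ z') h
  have hdecomp : ∀ F : Finset (Fin n) → ℂ, (∀ X, X ≠ Q → (∀ z, X ≠ Finset.univ.erase z) → F X = 0) →
      ∑ X, F X = F Q + ∑ z, F (Finset.univ.erase z) := by
    intro F hF
    rw [← Finset.sum_subset (Finset.subset_univ (insert Q (Finset.univ.image fun z : Fin n => Finset.univ.erase z)))]
    · rw [Finset.sum_insert hQnot, Finset.sum_image (fun z _ z' _ h => herase_inj h)]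
    · intro X _ hX
      rw [Finset.mem_insert, not_or, Finset.mem_image] at hX
      exact hF X hX.1 (fun z hz => hX.2 ⟨z, Finset.mem_univ _, hz.symm⟩)
  have he0 : G Q + ∑ z, G (Finset.univ.erase z) = 0 := by
    rw [← hdecomp G hGzero]
    have h1 := moebius_inversion fB ∅
    rw [hfB_small ∅ (by simp)] at h1
    have h2 : ∑ X ∈ Finset.univ.filter (fun X : Finset (Fin n) => ∅ ⊆ X),
        (-1 : ℂ) ^ (X.card - (∅ : Finset (Fin n)).card) * ∑ B ∈ Finset.univ.filter (fun B => X ⊆ B), fB B = ∑ X, G X := by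
      rw [Finset.filter_true_of_mem (fun X _ => Finset.empty_subset X)]
      refine Finset.sum_congr rfl fun X _ => ?_
      simp only [G, Finset.card_empty, Nat.sub_zero, hΨBfib X]
    rw [h2] at h1
    exact h1.symm
  have hei : ∀ i : Fin n, (if i ∈ Q then G Q else 0) + ∑ z, (if z ≠ i then G (Finset.univ.erase z) else 0) = 0 := by
    intro i
    have hdec := hdecomp (fun X => if i ∈ X then G X else 0) (fun X h1 h2 => by
      by_cases hi : i ∈ X
      · rw [if_pos hi, hGzero X h1 h2]
      · rw [if_neg hi])
    have hz : ∀ z : Fin n, (if i ∈ Finset.univ.erase z then G (Finset.univ.erase z) else 0)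
        = if z ≠ i then G (Finset.univ.erase z) else 0 := by
      intro z
      have : i ∈ Finset.univ.erase z ↔ z ≠ i := by simp [eq_comm]
      simp only [this]
    simp only [hz] at hdec
    rw [← hdec]
    have h1 := moebius_inversion fB {i}
    rw [hfB_small {i} (by simp)] at h1
    have h2 : ∑ X ∈ Finset.univ.filter (fun X : Finset (Fin n) => {i} ⊆ X),
        (-1 : ℂ) ^ (X.card - ({i} : Finset (Fin n)).card) * ∑ B ∈ Finset.univ.filter (fun B => X ⊆ B), fB B
        = -∑ X, (if i ∈ X then G X else 0) := by
      rw [Finset.sum_filter, ← Finset.sum_neg_distrib]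
      refine Finset.sum_congr rfl fun X _ => ?_
      by_cases hi : i ∈ X
      · have hsub : ({i} : Finset (Fin n)) ⊆ X := Finset.singleton_subset_iff.mpr hi
        have hcard : 1 ≤ X.card := Finset.card_pos.mpr ⟨i, hi⟩
        have hpow : (-1 : ℂ) ^ (X.card - 1) = -(-1 : ℂ) ^ X.card := by
          obtain ⟨c, hc⟩ : ∃ c, X.card = c + 1 := ⟨X.card - 1, by omega⟩
          rw [hc, Nat.add_sub_cancel, pow_succ]; ring
        rw [if_pos hsub, if_pos hi, Finset.card_singleton, hpow, ← hΨBfib X]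
        simp only [G]; ring
      · rw [if_neg (fun h => hi (Finset.singleton_subset_iff.mp h)), if_neg hi, neg_zero]
    rw [h2] at h1
    have : ∑ X, (if i ∈ X then G X else 0) = 0 := by
      have h3 : -∑ X, (if i ∈ X then G X else 0) = 0 := h1.symm
      rwa [neg_eq_zero] at h3
    exact this
  -- solve the linear system: G(univ.erase i) = −[i ∈ P] G Q, then G Q = 0
  have hGe : ∀ i, G (Finset.univ.erase i) = -(if i ∈ P then G Q else 0) := by
    intro i
    have h1 := hei i
    have h2 := he0
    have hsplit : ∑ z, G (Finset.univ.erase z) = G (Finset.univ.erase i) + ∑ z, (if z ≠ i then G (Finset.univ.erase z) else 0) := by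
      rw [← Finset.add_sum_erase Finset.univ _ (Finset.mem_univ i)]
      congr 1
      rw [← Finset.sum_subset (Finset.erase_subset i Finset.univ)]
      · refine Finset.sum_congr rfl fun z hz => ?_
        rw [if_pos (Finset.ne_of_mem_erase hz)]
      · intro z _ hz
        have : z = i := by simpa using hz
        rw [if_neg (by simp [this])]
    rw [hsplit] at h2
    by_cases hiP : i ∈ P
    · rw [if_pos hiP]
      rw [if_neg ((hmemQ i).not.mpr (not_not.mpr hiP))] at h1
      linear_combination h2 - h1
    · rw [if_neg hiP, neg_zero]
      rw [if_pos ((hmemQ i).mpr hiP)] at h1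
      linear_combination h2 - h1
  have hGQ : G Q = 0 := by
    have h2 := he0
    have hsum : ∑ z, G (Finset.univ.erase z) = -(2 : ℂ) * G Q := by
      rw [Finset.sum_congr rfl fun z _ => hGe z, Finset.sum_neg_distrib, ← Finset.sum_filter, Finset.filter_mem_eq_inter,
        Finset.univ_inter, Finset.sum_const, hPc]
      simp
    rw [hsum] at h2
    linear_combination -h2
  have hΨB_zero : ∀ X, ΨB X = 0 := by
    intro X
    have hG0 : G X = 0 := by
      by_cases hXQ : X = Q
      · rw [hXQ]; exact hGQ
      by_cases hXe : ∃ z, X = Finset.univ.erase z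
      · obtain ⟨z, rfl⟩ := hXe
        rw [hGe z, hGQ]; simp
      · push Not at hXe
        exact hGzero X hXQ hXe
    rcases mul_eq_zero.mp hG0 with h0 | h0
    · exact absurd h0 (pow_ne_zero _ (by norm_num))
    · exact h0
  have hfB : ∀ A, fB A = 0 :=
    eq_zero_of_sum_supersets fB fun T => by rw [← hΨBfib]; exact hΨB_zero T
  have hfA : ∀ J, fA J = 0 :=
    eq_zero_of_sum_supersets fA fun T => by
      rw [← hΨAfib]
      have := hEN T
      rwa [hΨB_zero, mul_zero, add_zero] at this
  -- conclusion
  intro k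
  by_cases hk : xl ∈ cols k
  · have hkB : k ∈ CB := Finset.mem_filter.mpr ⟨Finset.mem_univ _, hk⟩
    have := hfB (Finset.univ \ low k)
    simp only [fB] at this
    have hmem : k ∈ CB.filter (fun k' => Finset.univ \ low k' = Finset.univ \ low k) := Finset.mem_filter.mpr ⟨hkB, rfl⟩
    rw [Finset.sum_eq_single_of_mem k hmem] at this
    · exact this
    · intro k' hk' hne
      obtain ⟨hk'B, hlow⟩ := Finset.mem_filter.mp hk'
      exfalso; apply hne; apply hcols
      have hll : low k' = low k := by
        have := congrArg (fun A => Finset.univ \ A) hlow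
        simpa only [Finset.sdiff_sdiff_eq_self (Finset.subset_univ _)] using this
      rw [hcolsB k' (Finset.mem_filter.mp hk'B).2, hcolsB k hk, hll]
  · have hkA : k ∈ CA := Finset.mem_filter.mpr ⟨Finset.mem_univ _, hk⟩
    have := hfA (low k)
    simp only [fA] at this
    have hmem : k ∈ CA.filter (fun k' => low k' = low k) := Finset.mem_filter.mpr ⟨hkA, rfl⟩
    rw [Finset.sum_eq_single_of_mem k hmem] at this
    · exact this
    · intro k' hk' hne
      obtain ⟨hk'A, hlow⟩ := Finset.mem_filter.mp hk'
      exfalso; apply hne; apply hcols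
      rw [hcolsA k' (Finset.mem_filter.mp hk'A).2, hcolsA k hk, hlow]

end Tilt

end

end Summit.ValiantsHypothesis.ValiantsHypothesis.Theorems.BarrierLever.HiddenStates
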